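import Literature.Analysis.FluidPDE.PeriodicCylinderNeumannFrameWords
import Literature.Analysis.FluidPDE.PeriodicCylinderWordNorms
import Literature.Analysis.FluidPDE.Ferrari1993PressureEstimateReduction
import HarnessLib

/-!
# The data of the Neumann problem on the period cell by the Sobolev norms of `Δq` and `G`

Topic `Literature/Analysis/FluidPDE`. Support file (all results proved, no definitions) for the
discharge of `Literature.Analysis.FluidPDE.Ferrari1993_periodicCylinderPressureEstimate` (A. B.
Ferrari, Comm. Math. Phys. **155** (1993), Lemma 2, pp. 280–281). The frame-word and interior
estimates of the Neumann problem are stated through the real data size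
`neumannData L q G` (`PeriodicCylinderNeumannFrameWords`) and through `L²(cell)` sizes of words of
`Δ_K q`; the named fact is stated through the tree's Sobolev norms
`eSobolevDomainNorm k 2 (cylinderCell L) volume`. This file converts:

* `exists_neumannData_le` — `neumannData L q G ≤ C (𝒩₂(Δ_K q) + 𝒩₃(G))`, where
  `𝒩ₙ(h) = Σ_{m ≤ n} Σ_w cellL2 (X_{e∘w} h)` is the word sum of `‖h‖_{W^{n,2}(cell)}`
  (`toReal_eSobolevDomainNorm_eq_wordSum`); every term of the data is a word over `{J} ∪ {constants}`
  (`exists_cellL2_cylWord_jcWord_le`);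
* `exists_cellL2_cylGrad_le_wordSums` — `cellL2 (∇q) ≤ C (𝒩₂(Δ_K q) + 𝒩₃(G))` (the base Neumann
  estimate);
* `eSobolevDomainNorm_laplacian_eq_cylLap`, `eSobolevDomainNorm_gradient_eq_cylGrad` — the Sobolev
  norm on the cell only sees the values on the (open) cell
  (`SobolevApprox.eSobolevDomainNorm_congr`), whence `‖Δq‖_{H²(cell)} = ‖Δ_K q‖_{H²(cell)}` and
  `‖∇q‖_{H³(cell)} = ‖∇_K q‖_{H³(cell)}` for `q` smooth on the closed cylinder (`Δ q = Δ_K q`,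
  `∇q = ∇_K q` on the open cylinder).

All statements are folklore.

Mathlib/tree search: word sums and the `{J, const}` estimate are in `PeriodicCylinderWordNorms.lean`;
the locality of the Sobolev norm `SobolevApprox.eSobolevDomainNorm_congr` in
`FunctionSpaces/SobolevTraceDensityHigherProofs.lean`; `laplacian_eq_cylLap` in
`Ferrari1993PressureNeumannProblem.lean`.
-/

noncomputable section

open MeasureTheory Set Function Filter Topology TopologicalSpace WithLp Metric
open scoped ContDiff NNReal ENNReal InnerProductSpace RealInnerProductSpace Laplacian

namespace Literature.Analysis.FluidPDE

open Literature.Analysis.FunctionSpaces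

/-- Local notation for physical space `ℝ³ = EuclideanSpace ℝ (Fin 3)`. -/
local notation "ℝ³" => EuclideanSpace ℝ (Fin 3)

/-- Local notation for the closed unit cylinder `{r ≤ 1}`. -/
local notation "𝕂" => closure (SetLike.coe unitCylinder : Set (EuclideanSpace ℝ (Fin 3)))

variable {F : Type*} [NormedAddCommGroup F] [NormedSpace ℝ F]

/-! ### The word sums -/

/-- The word sum is monotone in the order. [folklore] -/
theorem wordSum_mono (L : ℝ) {m n : ℕ} (hmn : m ≤ n) (g : ℝ³ → F) :
    ∑ k ∈ Finset.range (m + 1), ∑ w : Fin k → Fin (Module.finrank ℝ ℝ³),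
        cellL2 L (cylWord (jcWord (constWord fun j => Module.finBasis ℝ ℝ³ (w j))) g) ≤
      ∑ k ∈ Finset.range (n + 1), ∑ w : Fin k → Fin (Module.finrank ℝ ℝ³),
        cellL2 L (cylWord (jcWord (constWord fun j => Module.finBasis ℝ ℝ³ (w j))) g) :=
  Finset.sum_le_sum_of_subset_of_nonneg (Finset.range_mono (by omega))
    fun _ _ _ => Finset.sum_nonneg fun _ _ => cellL2_nonneg L _

/-- The word sum is nonnegative. [folklore] -/
theorem wordSum_nonneg (L : ℝ) (n : ℕ) (g : ℝ³ → F) :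
    0 ≤ ∑ k ∈ Finset.range (n + 1), ∑ w : Fin k → Fin (Module.finrank ℝ ℝ³),
        cellL2 L (cylWord (jcWord (constWord fun j => Module.finBasis ℝ ℝ³ (w j))) g) :=
  Finset.sum_nonneg fun _ _ => Finset.sum_nonneg fun _ _ => cellL2_nonneg L _

/-- The zeroth word sum term is the size itself: `cellL2 g ≤ 𝒩ₙ(g)`. [folklore] -/
theorem cellL2_le_wordSum (L : ℝ) (n : ℕ) (g : ℝ³ → F) :
    cellL2 L g ≤ ∑ k ∈ Finset.range (n + 1), ∑ w : Fin k → Fin (Module.finrank ℝ ℝ³),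
        cellL2 L (cylWord (jcWord (constWord fun j => Module.finBasis ℝ ℝ³ (w j))) g) := by
  refine le_trans ?_ (wordSum_mono L (Nat.zero_le n) g)
  rw [Finset.sum_range_one, sum_fin_zero_fun, constWord_zero, jcWord_nil, cylWord_nil]

/-! ### The encoded tangential words -/

/-- The letters of an encoded tangential word are `J` or `e₂`. [folklore] -/
theorem norm_le_of_mem_tanEnc {β : List Bool} {v : ℝ³}
    (hv : some v ∈ β.map fun b => if b then none else some (cylBasis 2)) : ‖v‖ = 1 := by
  obtain ⟨b, -, hb⟩ := List.mem_map.1 hv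
  cases b
  · simp only [Bool.false_eq_true, ↓reduceIte, Option.some.injEq] at hb
    rw [← hb, norm_cylBasis]
  · simp at hb

/-! ### The data by the word sums -/

/-- **The data size of the Neumann problem by the word sums**:
`neumannData L q G ≤ C (𝒩₂(Δ_K q) + 𝒩₃(G))`. [folklore] -/
theorem exists_neumannData_le (L : ℝ) :
    ∃ C : ℝ, 0 ≤ C ∧ ∀ (q G : ℝ³ → ℝ), ContDiffOn ℝ ∞ q 𝕂 → ContDiffOn ℝ ∞ G 𝕂 →
      neumannData L q G ≤ C *
        ((∑ k ∈ Finset.range 3, ∑ w : Fin k → Fin (Module.finrank ℝ ℝ³),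
            cellL2 L (cylWord (jcWord (constWord fun j => Module.finBasis ℝ ℝ³ (w j))) (cylLap q))) +
          ∑ k ∈ Finset.range 4, ∑ w : Fin k → Fin (Module.finrank ℝ ℝ³),
            cellL2 L (cylWord (jcWord (constWord fun j => Module.finBasis ℝ ℝ³ (w j))) G)) := by
  set b := Module.finBasis ℝ ℝ³ with hb
  -- a bound for the letters
  set Mb : ℝ := 1 + ∑ k, ‖b k‖ with hMb
  have hMb1 : 1 ≤ Mb := le_add_of_nonneg_right (Finset.sum_nonneg fun k _ => norm_nonneg _)
  have hMb0 : 0 ≤ Mb := zero_le_one.trans hMb1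
  have hMbk : ∀ k, ‖b k‖ ≤ Mb := fun k =>
    (Finset.single_le_sum (f := fun k => ‖b k‖) (fun _ _ => norm_nonneg _) (Finset.mem_univ k)).trans
      (le_add_of_nonneg_left zero_le_one)
  -- the `{J, const}` estimate for lengths `≤ 3`
  have hK := fun n => exists_cellL2_cylWord_jcWord_le (F := ℝ) L hMb1 hMbk n
  choose K hK0 hK using hK
  set Kmax : ℝ := ∑ n ∈ Finset.range 4, K n with hKmax
  have hKmax0 : 0 ≤ Kmax := Finset.sum_nonneg fun n _ => hK0 n
  have hKle : ∀ n, n ≤ 3 → K n ≤ Kmax := fun n hn =>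
    Finset.single_le_sum (f := K) (fun n _ => hK0 n) (Finset.mem_range.2 (by omega))
  -- one encoded word of length `n ≤ 3` applied to `g`, bounded by `Kmax Mb³ 𝒩₃(g)` resp. `𝒩₂`
  have hword : ∀ (wd : List (Option ℝ³)) (n N : ℕ), wd.length = n → n ≤ N → N ≤ 3 →
      (∀ v, some v ∈ wd → ‖v‖ ≤ Mb) → ∀ (g : ℝ³ → ℝ), ContDiffOn ℝ ∞ g 𝕂 →
        cellL2 L (cylWord (jcWord wd) g) ≤ Kmax * Mb ^ 3 *
          ∑ k ∈ Finset.range (N + 1), ∑ w : Fin k → Fin (Module.finrank ℝ ℝ³),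
            cellL2 L (cylWord (jcWord (constWord fun j => b (w j))) g) := by
    intro wd n N hlen hnN hN hletters g hg
    refine (hK n wd hlen hletters g hg).trans ?_
    have h1 : K n * Mb ^ n ≤ Kmax * Mb ^ 3 :=
      mul_le_mul (hKle n (by omega)) (pow_le_pow_right₀ hMb1 (by omega)) (by positivity) hKmax0
    exact mul_le_mul h1 (wordSum_mono L hnN g) (wordSum_nonneg L n g) (by positivity)
  refine ⟨50 * (Kmax * Mb ^ 3), by positivity, fun q G hq hG => ?_⟩
  set N2 : ℝ := ∑ k ∈ Finset.range 3, ∑ w : Fin k → Fin (Module.finrank ℝ ℝ³),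
    cellL2 L (cylWord (jcWord (constWord fun j => b (w j))) (cylLap q)) with hN2
  set N3 : ℝ := ∑ k ∈ Finset.range 4, ∑ w : Fin k → Fin (Module.finrank ℝ ℝ³),
    cellL2 L (cylWord (jcWord (constWord fun j => b (w j))) G) with hN3
  have hN20 : 0 ≤ N2 := wordSum_nonneg L 2 _
  have hN30 : 0 ≤ N3 := wordSum_nonneg L 3 _
  have hLq : ContDiffOn ℝ ∞ (cylLap q) 𝕂 := contDiffOn_cylLap hq
  set A : ℝ := Kmax * Mb ^ 3 with hA
  have hA0 : 0 ≤ A := by positivity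
  -- the encoded tangential words
  have henc : ∀ β : List Bool, tanWord β = jcWord (β.map fun b => if b then none else some (cylBasis 2)) :=
    tanWord_eq_jcWord
  have hlenenc : ∀ β : List Bool, (β.map fun b => if b then none else some (cylBasis 2)).length = β.length :=
    fun β => List.length_map _
  have hlet : ∀ (β : List Bool) (v : ℝ³), some v ∈ (β.map fun b => if b then none else some (cylBasis 2)) → ‖v‖ ≤ Mb :=
    fun β v hv => (norm_le_of_mem_tanEnc hv).le.trans hMb1
  have hlet' : ∀ (β : List Bool) (i : Fin 3) (v : ℝ³),
      some v ∈ some (cylBasis i) :: (β.map fun b => if b then none else some (cylBasis 2)) → ‖v‖ ≤ Mb := by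
    intro β i v hv
    rcases List.mem_cons.1 hv with h | h
    · rw [Option.some.injEq] at h; rw [h, norm_cylBasis]; exact hMb1
    · exact hlet β v h
  have hlen2 : ∀ β ∈ tanLists₂, β.length ≤ 2 := by
    intro β hβ; simp only [tanLists₂, Finset.mem_insert, Finset.mem_singleton] at hβ
    rcases hβ with rfl | rfl | rfl | rfl | rfl | rfl | rfl <;> simp
  have hlen1 : ∀ β ∈ tanLists₁, β.length ≤ 1 := by
    intro β hβ; simp only [tanLists₁, Finset.mem_insert, Finset.mem_singleton] at hβ
    rcases hβ with rfl | rfl | rfl <;> simp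
  -- the five families
  have f1 : ∀ β ∈ tanLists₂, cellL2 L (cylWord (tanWord β) (cylLap q)) ≤ A * N2 := fun β hβ => by
    rw [henc β]
    exact hword _ β.length 2 (hlenenc β) (hlen2 β hβ) (by norm_num) (hlet β) _ hLq
  have f3 : ∀ β ∈ tanLists₂, cellL2 L (cylWord (tanWord β) G) ≤ A * N3 := fun β hβ => by
    rw [henc β]
    exact hword _ β.length 3 (hlenenc β) ((hlen2 β hβ).trans (by norm_num)) le_rfl (hlet β) _ hG
  have hgradword : ∀ (β : List Bool) (g : ℝ³ → ℝ), ContDiffOn ℝ ∞ g 𝕂 → ∀ (N : ℕ), β.length + 1 ≤ N → N ≤ 3 →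
      cellL2 L (cylGrad (cylWord (tanWord β) g)) ≤ 3 * (A * ∑ k ∈ Finset.range (N + 1),
        ∑ w : Fin k → Fin (Module.finrank ℝ ℝ³), cellL2 L (cylWord (jcWord (constWord fun j => b (w j))) g)) := by
    intro β g hg N hN hN3
    refine (cellL2_cylGrad_le_sum L (contDiffOn_cylWord_tanWord β hg)).trans ?_
    calc ∑ i : Fin 3, cellL2 L (cylDeriv (fun _ => cylBasis i) (cylWord (tanWord β) g))
        ≤ ∑ _i : Fin 3, A * ∑ k ∈ Finset.range (N + 1),
            ∑ w : Fin k → Fin (Module.finrank ℝ ℝ³), cellL2 L (cylWord (jcWord (constWord fun j => b (w j))) g) := by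
          refine Finset.sum_le_sum fun i _ => ?_
          have e : cylDeriv (fun _ => cylBasis i) (cylWord (tanWord β) g) =
              cylWord (jcWord (some (cylBasis i) :: β.map fun b => if b then none else some (cylBasis 2))) g := by
            rw [jcWord_cons, cylWord_cons, jcField_some, ← henc β]
          rw [e]
          exact hword _ (β.length + 1) N (by simp) hN hN3 (hlet' β i) g hg
      _ = 3 * (A * _) := by
          rw [Finset.sum_const, Finset.card_univ, Fintype.card_fin, nsmul_eq_mul]; norm_num
  have f2 : ∀ β ∈ tanLists₂, cellL2 L (cylGrad (cylWord (tanWord β) G)) ≤ 3 * (A * N3) := fun β hβ =>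
    hgradword β G hG 3 (by have := hlen2 β hβ; omega) le_rfl
  have f4 : ∀ β ∈ tanLists₁, cellL2 L (cylGrad (cylWord (tanWord β) (cylLap q))) ≤ 3 * (A * N2) := fun β hβ =>
    hgradword β (cylLap q) hLq 2 (by have := hlen1 β hβ; omega) (by norm_num)
  have f5 : ∀ i : Fin 3, cellL2 L (cylGrad (cylDeriv (fun _ => cylBasis i) (cylLap q))) ≤ 3 * (A * N2) := by
    intro i
    refine (cellL2_cylGrad_le_sum L (contDiffOn_cylDeriv contDiff_const hLq)).trans ?_
    calc ∑ j : Fin 3, cellL2 L (cylDeriv (fun _ => cylBasis j) (cylDeriv (fun _ => cylBasis i) (cylLap q)))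
        ≤ ∑ _j : Fin 3, A * N2 := by
          refine Finset.sum_le_sum fun j _ => ?_
          have e : cylDeriv (fun _ => cylBasis j) (cylDeriv (fun _ => cylBasis i) (cylLap q)) =
              cylWord (jcWord [some (cylBasis j), some (cylBasis i)]) (cylLap q) := rfl
          rw [e]
          refine hword _ 2 2 rfl le_rfl (by norm_num) (fun v hv => ?_) _ hLq
          simp only [List.mem_cons, Option.some.injEq, List.not_mem_nil, or_false] at hv
          rcases hv with rfl | rfl <;> (rw [norm_cylBasis]; exact hMb1)
      _ = 3 * (A * N2) := by rw [Finset.sum_const, Finset.card_univ, Fintype.card_fin, nsmul_eq_mul]; norm_num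
  -- the cardinalities
  have hcard2 : (tanLists₂.card : ℝ) = 7 := by simp [tanLists₂]
  have hcard1 : (tanLists₁.card : ℝ) = 3 := by simp [tanLists₁]
  unfold neumannData
  calc _ ≤ (∑ _β ∈ tanLists₂, (A * N2 + 3 * (A * N3) + A * N3)) + (∑ _β ∈ tanLists₁, 3 * (A * N2)) +
        ∑ _i : Fin 3, 3 * (A * N2) := by
        refine add_le_add (add_le_add (Finset.sum_le_sum fun β hβ => ?_) (Finset.sum_le_sum fun β hβ => f4 β hβ))
          (Finset.sum_le_sum fun i _ => f5 i)
        exact add_le_add (add_le_add (f1 β hβ) (f2 β hβ)) (f3 β hβ)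
    _ = 7 * (A * N2 + 3 * (A * N3) + A * N3) + 3 * (3 * (A * N2)) + 3 * (3 * (A * N2)) := by
        rw [Finset.sum_const, Finset.sum_const, Finset.sum_const, Finset.card_univ, Fintype.card_fin,
          nsmul_eq_mul, nsmul_eq_mul, nsmul_eq_mul, hcard2, hcard1]; norm_num
    _ ≤ 50 * (Kmax * Mb ^ 3) * (N2 + N3) := by rw [hA]; nlinarith

/-- **The gradient by the word sums** (base Neumann estimate): for `L > 0` there is `C` with
`cellL2 (∇q) ≤ C (𝒩₂(Δ_K q) + 𝒩₃(G))` for all smooth periodic `q`, `G` with `x_h·∇q = G` on the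
wall. [folklore] -/
theorem exists_cellL2_cylGrad_le_wordSums {L : ℝ} (hL : 0 < L) :
    ∃ C : ℝ, 0 ≤ C ∧ ∀ (q G : ℝ³ → ℝ), ContDiffOn ℝ ∞ q 𝕂 → ContDiffOn ℝ ∞ G 𝕂 →
      IsAxiallyPeriodic L q → IsAxiallyPeriodic L G →
      (∀ x ∈ frontier (unitCylinder : Set ℝ³), cylDeriv (fun y => horizontalProj y) q x = G x) →
      cellL2 L (cylGrad q) ≤ C *
        ((∑ k ∈ Finset.range 3, ∑ w : Fin k → Fin (Module.finrank ℝ ℝ³),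
            cellL2 L (cylWord (jcWord (constWord fun j => Module.finBasis ℝ ℝ³ (w j))) (cylLap q))) +
          ∑ k ∈ Finset.range 4, ∑ w : Fin k → Fin (Module.finrank ℝ ℝ³),
            cellL2 L (cylWord (jcWord (constWord fun j => Module.finBasis ℝ ℝ³ (w j))) G)) := by
  set b := Module.finBasis ℝ ℝ³ with hb
  set Mb : ℝ := 1 + ∑ k, ‖b k‖ with hMb
  have hMb1 : 1 ≤ Mb := le_add_of_nonneg_right (Finset.sum_nonneg fun k _ => norm_nonneg _)
  have hMbk : ∀ k, ‖b k‖ ≤ Mb := fun k =>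
    (Finset.single_le_sum (f := fun k => ‖b k‖) (fun _ _ => norm_nonneg _) (Finset.mem_univ k)).trans
      (le_add_of_nonneg_left zero_le_one)
  obtain ⟨C₁, hC₁0, hC₁⟩ := exists_cellL2_cylGrad_le_of_neumann hL
  obtain ⟨K₁, hK₁0, hK₁⟩ := exists_cellL2_cylWord_jcWord_le (F := ℝ) L hMb1 hMbk 1
  refine ⟨C₁ * (2 + 3 * K₁ * Mb), by positivity, fun q G hq hG hqp hGp hN => ?_⟩
  set N2 : ℝ := ∑ k ∈ Finset.range 3, ∑ w : Fin k → Fin (Module.finrank ℝ ℝ³),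
    cellL2 L (cylWord (jcWord (constWord fun j => b (w j))) (cylLap q)) with hN2
  set N3 : ℝ := ∑ k ∈ Finset.range 4, ∑ w : Fin k → Fin (Module.finrank ℝ ℝ³),
    cellL2 L (cylWord (jcWord (constWord fun j => b (w j))) G) with hN3
  have hN20 : 0 ≤ N2 := wordSum_nonneg L 2 _
  have hN30 : 0 ≤ N3 := wordSum_nonneg L 3 _
  have h1 : cellL2 L (cylLap q) ≤ N2 := cellL2_le_wordSum L 2 _
  have h3 : cellL2 L G ≤ N3 := cellL2_le_wordSum L 3 _
  have h2 : cellL2 L (cylGrad G) ≤ 3 * K₁ * Mb * N3 := by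
    refine (cellL2_cylGrad_le_sum L hG).trans ?_
    calc ∑ i : Fin 3, cellL2 L (cylDeriv (fun _ => cylBasis i) G) ≤ ∑ _i : Fin 3, K₁ * Mb * N3 := by
          refine Finset.sum_le_sum fun i _ => ?_
          have e : cylDeriv (fun _ => cylBasis i) G = cylWord (jcWord [some (cylBasis i)]) G := rfl
          rw [e]
          refine (hK₁ _ rfl (fun v hv => ?_) G hG).trans ?_
          · simp only [List.mem_cons, Option.some.injEq, List.not_mem_nil, or_false] at hv
            rw [hv, norm_cylBasis]; exact hMb1
          · rw [pow_one]
            exact mul_le_mul_of_nonneg_left (wordSum_mono L (by norm_num : 1 ≤ 3) G) (by positivity)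
      _ = 3 * K₁ * Mb * N3 := by rw [Finset.sum_const, Finset.card_univ, Fintype.card_fin, nsmul_eq_mul]; ring
  calc cellL2 L (cylGrad q) ≤ C₁ * (cellL2 L (cylLap q) + cellL2 L (cylGrad G) + cellL2 L G) := hC₁ q G hq hG hqp hGp hN
    _ ≤ C₁ * (N2 + 3 * K₁ * Mb * N3 + N3) := mul_le_mul_of_nonneg_left (by linarith) hC₁0
    _ ≤ C₁ * (2 + 3 * K₁ * Mb) * (N2 + N3) := by
        have : 0 ≤ K₁ * Mb := by positivity
        have h4 : N2 + 3 * K₁ * Mb * N3 + N3 ≤ (2 + 3 * K₁ * Mb) * (N2 + N3) := by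
          nlinarith [mul_nonneg this hN20]
        calc _ ≤ C₁ * ((2 + 3 * K₁ * Mb) * (N2 + N3)) := mul_le_mul_of_nonneg_left h4 hC₁0
          _ = _ := by ring

/-! ### The Sobolev norm on the cell only sees the open cell -/

/-- `‖Δq‖_{H^k(cell)} = ‖Δ_K q‖_{H^k(cell)}` for `q` smooth on the closed cylinder. [folklore] -/
theorem eSobolevDomainNorm_laplacian_eq_cylLap (L : ℝ) (k : ℕ) {q : ℝ³ → ℝ} (hq : ContDiffOn ℝ ∞ q 𝕂) :
    eSobolevDomainNorm k 2 (cylinderCell L) volume (Δ q) = eSobolevDomainNorm k 2 (cylinderCell L) volume (cylLap q) :=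
  SobolevApprox.eSobolevDomainNorm_congr fun _ hx =>
    laplacian_eq_cylLap hq (cylinderCell_le_unitCylinder L hx)

/-- `‖∇q‖_{H^k(cell)} = ‖∇_K q‖_{H^k(cell)}` for `q` smooth on the closed cylinder (`∇q = ∇_K q` on the
open cylinder holds for every `q`, `cylGrad_eq_gradient`, so the smoothness hypothesis is not used;
it is kept for the signature of the callers in `Ferrari1993PressureEstimateProofs`). [folklore] -/
theorem eSobolevDomainNorm_gradient_eq_cylGrad (L : ℝ) (k : ℕ) {q : ℝ³ → ℝ} (_hq : ContDiffOn ℝ ∞ q 𝕂) :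
    eSobolevDomainNorm k 2 (cylinderCell L) volume (gradient q) =
      eSobolevDomainNorm k 2 (cylinderCell L) volume (cylGrad q) :=
  SobolevApprox.eSobolevDomainNorm_congr fun _ hx =>
    (cylGrad_eq_gradient q (cylinderCell_le_unitCylinder L hx)).symm

end Literature.Analysis.FluidPDE
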